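import Summits.BirchSwinnertonDyer.BirchSwinnertonDyer.Theorems.ByReductionTypeAtTwoAdditiveInertDoorLower
import Literature.NumberTheory.EllipticCurves.Rank1Residual.Typed.X5DescentRoute
import HarnessLib

/-!
# Route `ByReductionTypeAtTwo` (rung K4), crux `AdditiveRankZeroAtTwo` (item
# stmt-BirchSwinnertonDyer-19098), DEFECT-`≥ 3` sub-class: when the inert twist is DECIDED by descent, the
# class's BSD₂ IS the `2`-part of BSD over ONE quadratic field (seat `bsd-2adic-addL2x`, GEN 2)

HONEST FRAMING (cell `bsd-2adic`, run/shared/lean/pub/bsd-2adic/, HUMAN RULINGS D-0036/D-0074):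
theorems only; NO new definition; displayed PRINT inputs Gross–Zagier–Kolyvagin (`hGZK`), modularity
(`hmod`), Milne 1972 any-model (`hMilneC`); nothing else asserted; no class closed; nothing booked; BSD is
not proved by any of this. PARTITION (D-0054): X5@2 ADDITIVE, defect-`≥ 3` sub-class (1 382 book230
classes) × p = 2 — types-the-object-of; closes none.

WHAT THIS FILE ADDS to the lower-halves door (`…AdditiveInertDoorLower.lean`, p535183, whose per-class
shape displays PRINT + two LOWER certificates + ONE research binder `hK : MissingPPartOverCAt (W.baseChange K) 2`).
The GEN 2 census (kits j280432 / j280560 / j280941, tag bsd, evidence on 19098) found, for 1 381 of the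
1 382 class representatives of the block, an inert `D` of record whose twist `Wd` carries a LEVEL-`0`
descent datum: `Ш(Wd)[2] = 0` (PARI `ellrank` = 2-descent returns `[0,0,0]`, i.e. `Sel₂(Wd) = Wd(ℚ)[2]`) and
`#Ш_an(Wd)` odd (`ellL1`/`ellbsd`). For such a pair NO certificate about `W` is needed and the research
binder becomes an EQUIVALENCE:
* `bsdp_two_iff_overKC_at_of_levelZero_twist`: PRINT + the twist's level-`0` datum ⟹ `BSDp Wd 2` OUTRIGHT
  (`Typed.X5.bsdp_two_of_descentCertificateAt`) and `BSDp W 2 ⟺ MissingPPartOverCAt (W.baseChange K) 2`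
  (lane A's exactness `AdditivePotMult.missingPPartOverCAt_baseChange_iff_bsdp`).
Reading: for 1 381 / 1 382 classes of the block, BSD₂ of the class and the W-addL2x-1′ object («Delbourgo
1998 over the inert quadratic base, signed, p = 2») at ONE explicit field `ℚ(√D)` (|D| ≤ 301) are the SAME
statement; the remaining class (285496a1) keeps the two-lower-certificate shape (`…AdditiveInstance285496a.lean`).
Instance: `Theorems.bsdp_two_8092j1_iff_overKC_sqrt37` (appended to `…AdditiveInstance8092j.lean`).

References: [Milne1972ArithmeticAV] §1 Thm. 1 (through [DokchitserDokchitserAnnals2010] §2.1);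
[Miller2011LMS] Def. 1.1 (the currency `MissingPPartAt` / `X5.DescentCertificateAt`).
-/

set_option autoImplicit false
-- the Theorems namespace of this sub repeats the summit name by design (D-0017 nested layout)
set_option linter.dupNamespace false

noncomputable section

open scoped Classical

open WeierstrassCurve Literature.NumberTheory.EllipticCurves
  Literature.NumberTheory.EllipticCurves.Rank1Residual
  Literature.NumberTheory.EllipticCurves.Rank1Residual.Typed
  Summit.BirchSwinnertonDyer.Rank1Residual.AdditivePotMult
  Summit.BirchSwinnertonDyer.BirchSwinnertonDyer.Theses.ByReductionTypeAtTwo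

namespace Summit.BirchSwinnertonDyer.BirchSwinnertonDyer.Theorems

section Decided

variable (W : WeierstrassCurve ℚ) [W.IsElliptic] [W.IsGloballyMinimal]
  (K : Type) [Field K] [NumberField K]
  (Wd : WeierstrassCurve ℚ) [Wd.IsElliptic] [Wd.IsGloballyMinimal]

/-- **Per-class EXACTNESS at one field.** For ONE globally minimal `W` of analytic rank `≤ 1`, ONE
quadratic field `K` and a globally minimal model `Wd` of `W^{(d_K)}` of analytic rank `≤ 1` carrying a
LEVEL-`0` descent datum — `Ш(Wd)[2] = 0` (`hSha2`: the 2-descent `Sel₂(Wd) = Wd(ℚ)[2]`) and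
`#Ш_an(Wd) = q_d` with `ord₂ q_d = 0` (`hqd`, `hvd`) — PRINT {`hGZK`, `hmod`, `hMilneC`} give `BSDp Wd 2`
OUTRIGHT and `BSDp W 2 ⟺ MissingPPartOverCAt (W.baseChange K) 2`. No certificate about `W`, no
Cassels–Tate input, no Euler system. [cite: Milne1972ArithmeticAV, §1 Thm. 1 (through DokchitserDokchitserAnnals2010 §2.1)]
[cite: Miller2011LMS, Def. 1.1] -/
theorem bsdp_two_iff_overKC_at_of_levelZero_twist
    (hGZK : rank_eq_analyticRank_of_analyticRank_le_one) (hmod : hasEntireLFunction_rat)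
    (hMilneC : Milne1972.bsdQuotient_baseChange_quadratic_anyModel)
    (hr : W.analyticRank ≤ 1) (h2 : Module.finrank ℚ K = 2)
    (hWd : ∃ C : VariableChange ℚ, C • W.quadraticTwist (NumberField.discr K : ℚ) = Wd)
    (hrd : Wd.analyticRank ≤ 1) (hSha2 : ∀ x : Wd.sha, 2 • x = 0 → x = 0) {qd : ℚ}
    (hqd : shaAn Wd = (qd : ℂ)) (hvd : padicValRat 2 qd = 0) :
    (BSDp W 2 ↔ MissingPPartOverCAt (W.baseChange K) 2) ∧ BSDp Wd 2 := by
  haveI : Fact (Nat.Prime 2) := ⟨Nat.prime_two⟩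
  -- the level-0 descent datum of the twist: `Ш[2] = 0`, `#Ш[1] = 1`, `ord₂ #Ш_an = 0`
  have hstab : ∀ x : Wd.sha, 2 ^ (0 + 1) • x = 0 → 2 ^ 0 • x = 0 := fun x hx => by
    simpa using hSha2 x (by simpa using hx)
  have hcard : Nat.card (AddSubgroup.torsionBy Wd.sha (2 ^ 0 : ℕ)) = 2 ^ 0 := by
    have hbot : AddSubgroup.torsionBy Wd.sha (2 ^ 0 : ℕ) = ⊥ := by
      rw [eq_bot_iff]
      intro x hx
      rw [AddSubgroup.mem_bot]
      simpa using AddSubgroup.torsionBy.nsmul_iff.mp hx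
    rw [hbot, AddSubgroup.card_bot, pow_zero]
  have hBSDd : BSDp Wd 2 :=
    X5.bsdp_two_of_descentCertificateAt Wd hGZK hrd
      (X5.descentCertificateAt_of_level Wd hstab hcard hqd (by exact_mod_cast hvd))
  exact ⟨(missingPPartOverCAt_baseChange_iff_bsdp W 2 K Wd hGZK hmod hMilneC hr h2 hWd hrd hBSDd).symm,
    hBSDd⟩

/-- **Corollary (the research binder as the ONLY display)**: under the same data, `hK` ⟹
`BSDp W 2 ∧ BSDp Wd 2`. [cite: Milne1972ArithmeticAV, §1 Thm. 1] -/
theorem bsdp_two_of_overKC_at_of_levelZero_twist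
    (hGZK : rank_eq_analyticRank_of_analyticRank_le_one) (hmod : hasEntireLFunction_rat)
    (hMilneC : Milne1972.bsdQuotient_baseChange_quadratic_anyModel)
    (hr : W.analyticRank ≤ 1) (h2 : Module.finrank ℚ K = 2)
    (hWd : ∃ C : VariableChange ℚ, C • W.quadraticTwist (NumberField.discr K : ℚ) = Wd)
    (hrd : Wd.analyticRank ≤ 1) (hSha2 : ∀ x : Wd.sha, 2 • x = 0 → x = 0) {qd : ℚ}
    (hqd : shaAn Wd = (qd : ℂ)) (hvd : padicValRat 2 qd = 0)
    (hK : MissingPPartOverCAt (W.baseChange K) 2) : BSDp W 2 ∧ BSDp Wd 2 := by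
  obtain ⟨hiff, hd⟩ := bsdp_two_iff_overKC_at_of_levelZero_twist W K Wd hGZK hmod hMilneC hr h2 hWd hrd
    hSha2 hqd hvd
  exact ⟨hiff.mpr hK, hd⟩

end Decided

end Summit.BirchSwinnertonDyer.BirchSwinnertonDyer.Theorems

end
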